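import Summits.Ventures.CertifiedManyBodySolver.Theorems.M3x2EdgeSplitSymReplayOutRouteMK
import HarnessLib

/-!
# SymReplay checker — HIERARCHICAL routing: the two-level split with the secondary filter BEFORE the Gram dot («MF»), and
its packed closing over `J·L` modules

(team lb-sym, cell hub-lb; hub-lb-sym-eng-4 g2, after the E₁ coarse-key census j315902 (crit-1 l.2020 verdict rule ⇒
HIERARCHICAL: 16 coarse classes above 3e6 terms hold 87 % of the mass).  ADDITIVE on T20d `…OutRouteM2` (`momKey₂`,
`shareRFastM₂`, `shareRFastM₂_perm`) and on this seat's `…OutRouteMK/MC/HS`; nothing landed is touched.)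

WHY.  With a COARSE routing table (E₁: 164 classes instead of 5 444; targets per module a handful; lookup term ≈ 1–3 s per
module instead of 3.85e4 s total) the heavy classes must be SUB-SPLIT by a secondary orbit-invariant word key `κ₂` (T20d §(o):
module `(i, f)` of `J·L`).  The landed `shareRFastM₂ … i f = (shareRFastM … i).filter (κ₂ % L = f)` evaluates the Gram dot of
EVERY hit of class-slot `i` in each of the `L` sub-modules (dot ≈ 32 µs at `K ≈ 40` vs ≈ 2 µs for the word test) — `L`× the
dot work.  `rowFastF` tests `κ₂` on the product word FIRST and computes the dot only for kept hits; the result is the same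
list (`shareRFastMF_eq`), so T20d's permutation lemma and every closing apply.

CONTENTS.  `rowFastF`, `shareRWithMF`, **`shareRFastMF S K gbs hm κ₂ J L i f`**; list identities `filterMap_filter_word`,
`rowFastF_eq : rowFastF … P₂ = (rowFast …).filter (wordPred P₂)`, `shareRWithMF_eq`, **`shareRFastMF_eq : shareRFastMF … i f =
shareRFastM₂ … i f`**; `shareRFastMF_perm` (T20d's, transported); module indexing over `J·L`: `S m := shareRFastMF … (m / L) (m % L)`,
**`shareRFastMF_perm_lin`**; closings **`energyDensity_ge_of_outroutePMF`** (PACKED facts, `J·L` modules, hypotheses = T20c's +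
`oP κ₂ L hL`) and `energyDensity_ge_of_outrouteMF2` (E3 box canon).  MODULE GRAMMAR (E-class, coarse table `tabC`, `L` sub-slots):
per module `m < J·L`: `out_m : PackedNF.ppipeOKHBZ lo hi PackedNF.oracleV3 (shareRFastMF momSpecC cert gbs tabC κ₂ J L (m / L)
(m % L)) = true := by native_decide`; close `energyDensity_ge_of_outroutePMF momSpecC cert hwf hRok PackedNF.oracleV3 tabC κ₂ J L
hJ hL lo hi hbox hcov hfacts`.  Standard axioms; no `native_decide` here.

HONEST FRAMING: an enumeration COST lever (same terms, dot computed only where kept); no certificate lands by this file; no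
bound of record moves; no summit or crux statement is proved here; nothing here predicts superconductivity.
-/

namespace Summit.Ventures.CertifiedManyBodySolver.Theorems.SymReplay

open Literature.MathematicalPhysics.QuantumLattice
open Literature.MathematicalPhysics.QuantumLattice.HubbardWave0
open Literature.MathematicalPhysics.QuantumLattice.ThermodynamicLimit
open Literature.Probability.LatticeModels
open Literature.MathematicalPhysics.QuantumManyBody.StateRelaxation
open Summit.Ventures.CertifiedManyBodySolver.Theorems.WardSlot

section Filtered

variable {M : Type} [DecidableEq M] [Hashable M]

/-- **One representative row with the secondary test BEFORE the dot** (`P₂` on the product word). -/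
def rowFastF (S : MomSpec M) (a : QPoly × List (ℚ × ℕ)) (wmap : Std.HashMap M (List (List (ℚ × ℕ) × (ℚ × Word))))
    (m s : ℚ) (T : List M) (P₂ : Word → Bool) : QPoly :=
  (padj a.1).flatMap fun t =>
    T.flatMap fun mt =>
      (wmap.getD (S.sub mt (mom S t.2)) []).filterMap fun x =>
        if P₂ (t.2 ++ x.2.2) then stepOpt a m s t x else none

/-- R-part of sub-module `(i, f)`: targets of class-slot `i`, secondary filter `κ₂ % L = f` before the dot. -/
def shareRWithMF (S : MomSpec M) (K : SymCertR) (gbs : List (List QPoly)) (T : List M) (P₂ : Word → Bool) : QPoly :=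
  (K.gramR.zip gbs).flatMap fun Bg =>
    let wmap := bucketOf S (wflat (Bg.2.zip Bg.1.rows))
    (Bg.1.reps.zip Bg.1.rows).flatMap fun a => rowFastF S a wmap Bg.1.moves.length Bg.1.scale T P₂

/-- **Sub-module `(i, f)`'s share, secondary filter before the dot** (same list as T20d's `shareRFastM₂ … i f`). -/
def shareRFastMF (S : MomSpec M) (K : SymCertR) (gbs : List (List QPoly)) (hm : MomTable M) (κ₂ : Word → ℕ)
    (J L i f : ℕ) : QPoly :=
  let P := wordPred (inSlotW (momKey S hm) J i)
  let P₂ : Word → Bool := fun w => κ₂ w % L == f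
  (baseShareF K.toSymCert P).filter (wordPred P₂) ++
  ((pscale (-1) (K.gramM.flatMap fun B => (gramBlockPoly B).filter P)).filter (wordPred P₂) ++
    shareRWithMF S K gbs (targetsM hm J i) P₂)

/-- Filtering the emitted terms by their word = testing the word before emitting. -/
theorem filterMap_filter_word (a : QPoly × List (ℚ × ℕ)) (m s : ℚ) (t : ℚ × Word) (P₂ : Word → Bool)
    (l : List (List (ℚ × ℕ) × (ℚ × Word))) :
    (l.filterMap (stepOpt a m s t)).filter (wordPred P₂) =
      l.filterMap fun x => if P₂ (t.2 ++ x.2.2) then stepOpt a m s t x else none := by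
  rw [List.filter_filterMap]
  refine List.filterMap_congr fun x _ => ?_
  unfold stepOpt wordPred
  by_cases hg : sdot a.2 x.1 = 0
  · simp [hg]
  · by_cases hp : P₂ (t.2 ++ x.2.2) = true
    · simp [hg, hp]
    · simp [hg, hp]

/-- **Filtered row = landed row, filtered** (list equality). -/
theorem rowFastF_eq (S : MomSpec M) (a : QPoly × List (ℚ × ℕ)) (wmap : Std.HashMap M (List (List (ℚ × ℕ) × (ℚ × Word))))
    (m s : ℚ) (T : List M) (P₂ : Word → Bool) :
    rowFastF S a wmap m s T P₂ = (rowFast S a wmap m s T).filter (wordPred P₂) := by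
  unfold rowFastF rowFast
  rw [List.filter_flatMap]
  refine List.flatMap_congr fun t _ => ?_
  rw [List.filter_flatMap]
  refine List.flatMap_congr fun mt _ => ?_
  exact (filterMap_filter_word a m s t P₂ _).symm

/-- Filtered R-part = landed R-part, filtered. -/
theorem shareRWithMF_eq (S : MomSpec M) (K : SymCertR) (gbs : List (List QPoly)) (T : List M) (P₂ : Word → Bool) :
    shareRWithMF S K gbs T P₂ = (shareRWithM S K gbs T).filter (wordPred P₂) := by
  unfold shareRWithMF shareRWithM
  rw [List.filter_flatMap]
  refine List.flatMap_congr fun Bg _ => ?_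
  simp only [List.filter_flatMap]
  refine List.flatMap_congr fun a _ => ?_
  exact rowFastF_eq S a _ _ _ T P₂

/-- **THE BRIDGE: the pre-filtered sub-module share IS T20d's `shareRFastM₂`** (list equality). -/
theorem shareRFastMF_eq (S : MomSpec M) (K : SymCertR) (gbs : List (List QPoly)) (hm : MomTable M) (κ₂ : Word → ℕ)
    (J L i f : ℕ) : shareRFastMF S K gbs hm κ₂ J L i f = shareRFastM₂ S K gbs hm κ₂ J L i f := by
  unfold shareRFastMF shareRFastM₂ shareRFastM
  simp only [List.filter_append, shareRWithMF_eq]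

/-- Its permutation lemma (T20d's `shareRFastM₂_perm`, transported). -/
theorem shareRFastMF_perm (S : MomSpec M) (K : SymCertR) (hm : MomTable M) (κ₂ : Word → ℕ) {J L : ℕ} (hJ : 0 < J)
    (hL : 0 < L) (i f : ℕ) (hf : f < L) (hcov : coverM S K (K.gramR.map genBasis) hm = true) :
    (shareRFastMF S K (K.gramR.map genBasis) hm κ₂ J L i f).Perm (shareR K (momKey₂ S hm κ₂ J L) (J * L) (L * i + f)) := by
  rw [shareRFastMF_eq]; exact shareRFastM₂_perm S K hm κ₂ hJ hL i f hf hcov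

/-- **Linear module index**: module `m < J·L` is sub-module `(m / L, m % L)`; its share is a permutation of slot `m` of the
composite-key spec share. -/
theorem shareRFastMF_perm_lin (S : MomSpec M) (K : SymCertR) (hm : MomTable M) (κ₂ : Word → ℕ) {J L : ℕ} (hJ : 0 < J)
    (hL : 0 < L) (hcov : coverM S K (K.gramR.map genBasis) hm = true) (m : ℕ) :
    (shareRFastMF S K (K.gramR.map genBasis) hm κ₂ J L (m / L) (m % L)).Perm (shareR K (momKey₂ S hm κ₂ J L) (J * L) m) := by
  have h := shareRFastMF_perm S K hm κ₂ hJ hL (m / L) (m % L) (Nat.mod_lt m hL) hcov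
  rwa [Nat.div_add_mod m L] at h

/-- **PACKED grammar, hierarchical routing (`J·L` modules):** per module `m < J·L` one file
`theorem out_m : PackedNF.ppipeOKHBZ lo hi oP (shareRFastMF S K (K.gramR.map genBasis) hm κ₂ J L (m / L) (m % L)) = true :=
by native_decide`; `hfacts : OutFactsP lo hi oP (fun m => shareRFastMF … (m / L) (m % L)) 0 (J * L)`. -/
theorem energyDensity_ge_of_outroutePMF (S : MomSpec M) (K : SymCertR) (hwf : wellFormed K.expand = true)
    (hRok : K.gramR.all (gramBlockROK K.frame) = true) (oP : PackedNF.PWord → PackedNF.PHint) (hm : MomTable M)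
    (κ₂ : Word → ℕ) (J L : ℕ) (hJ : 0 < J) (hL : 0 < L) (lo hi : ℤ × ℤ) (hbox : boxLicence K.frame lo hi = true)
    (hcov : coverM S K (K.gramR.map genBasis) hm = true)
    (hfacts : OutFactsP lo hi oP (fun m => shareRFastMF S K (K.gramR.map genBasis) hm κ₂ J L (m / L) (m % L)) 0 (J * L)) :
    ((symValueR K : ℚ) : ℝ) ≤ energyDensityTT' 1 0 8 (7 / 8) :=
  energyDensity_ge_of_outroutePS K hwf hRok oP (momKey₂ S hm κ₂ J L) (J * L) (Nat.mul_pos hJ hL) _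
    (fun m _ => shareRFastMF_perm_lin S K hm κ₂ hJ hL hcov m) lo hi hbox hfacts

/-- E3 (box canon) grammar, hierarchical routing: `out_m : isZero (canonNFZB lo hi (shareRFastMF … (m / L) (m % L))) = true`. -/
theorem energyDensity_ge_of_outrouteMF2 (S : MomSpec M) (K : SymCertR) (hwf : wellFormed K.expand = true)
    (hRok : K.gramR.all (gramBlockROK K.frame) = true) (hm : MomTable M) (κ₂ : Word → ℕ) (J L : ℕ) (hJ : 0 < J) (hL : 0 < L)
    (lo hi : ℤ × ℤ) (hbox : boxLicence K.frame lo hi = true) (hcov : coverM S K (K.gramR.map genBasis) hm = true)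
    (hfacts : OutFactsSB K (fun m => shareRFastMF S K (K.gramR.map genBasis) hm κ₂ J L (m / L) (m % L)) lo hi 0 (J * L)) :
    ((symValueR K : ℚ) : ℝ) ≤ energyDensityTT' 1 0 8 (7 / 8) :=
  energyDensity_ge_of_outrouteSB K hwf hRok (momKey₂ S hm κ₂ J L) (J * L) (Nat.mul_pos hJ hL) _
    (fun m _ => shareRFastMF_perm_lin S K hm κ₂ hJ hL hcov m) lo hi hbox hfacts

end Filtered

end Summit.Ventures.CertifiedManyBodySolver.Theorems.SymReplay
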